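import Summits.ValiantsHypothesis.ValiantsHypothesis.Theorems.KPlusLogSqLawTropicalPermutationChanges
import Summits.ValiantsHypothesis.ValiantsHypothesis.Theorems.KPlusLogSqLawTropicalBSymmetry

/-!
# Route `KPlusLogSqLaw`, crux `TropicalB` — COLUMN-DIAGONALLY-DOMINANT designs: the identity is the only dominant permutation

HONEST FRAMING.  Helper toward the registered stubs `stub_tropThin` / `stub_tropFat` of
`Cruxes/TropicalB/Lines/birth.lean` (crux `Summit.ValiantsHypothesis.ValiantsHypothesis.Theses.KPlusLogSqLaw.TropicalB`,
ledger item `stmt-ValiantsHypothesis-19771`, route `KPlusLogSqLaw`; cell `pub-symmetroid`, seat `val-sym-trop-p3`,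
2026-08-26).  Register-census NO-GO row #3 (companions: `…TropicalBSeparable`, `…TropicalBClassUniform`); nothing
here bounds `TropicalB` for general designs, and nothing bears on `KPlusLogSqLaw`, `MatrixDescartes` or `VP ≠ VNP`.

If in every column the DIAGONAL entry carries every class present in that column and is strictly cheaper than every
off-diagonal entry of the same class (`ε a b l ≠ 0 → ε b b l ≠ 0` and `a ≠ b → v b b l < v a b l`; recall the weight
subtracts `v`), then replacing the permutation of any present term by the identity keeps it present and raises its weight
strictly unless the permutation already is the identity.  Hence every dominant term has permutation `1`
(`perm_eq_one_of_dominant_diagDominant`), only class flips occur along a chain, and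
`diagDominant_chain_le : n ≤ m·(K−1)` (val-sym-lift-p2's permutation fibre); `diagDominant_kPlusLogSq` (`C = 2`).
Reading: a permutation register needs, somewhere, an off-diagonal class that beats the diagonal of its column at some slope —
in SHIFT-THREE the shift penalty `pen(p)` is beaten by the slope gain `θ·D` of the wrapping class. [folklore]
-/

set_option linter.dupNamespace false
set_option autoImplicit false

namespace Summit.ValiantsHypothesis.ValiantsHypothesis.Theorems.KPlusLogSqLaw

open Summit.ValiantsHypothesis.ValiantsHypothesis.Theorems.MatrixDescartes.Negative
open Summit.ValiantsHypothesis.ValiantsHypothesis.Theorems.LacunarySymmetroidMatrixDescartes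
open Summit.ValiantsHypothesis.ValiantsHypothesis.Theorems.LacunarySymmetroidMatrixDescartes.TropicalCensus
open scoped BigOperators
open Finset

section DiagDominant

variable {m K : ℕ}

/-- **The improver principle** (the common core of the register no-go rows and of the symmetry principle): a dominant term
is a fixed point of every map on terms that keeps it present and does not lower its weight.  One line from
val-sym-trop-p2's `eq_of_isDominant` (no ties at the top).  Instances: relabelling by a symmetry (`…TropicalBSymmetry`,
`…SymmetricOrbits`), adding potentials along a gauge symmetry (`…GaugeSymmetry`), swapping two equal-class columns
(`…Separable`), replacing the permutation by the cost minimiser (`…ClassUniform`) or by the identity (below). [folklore] -/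
theorem fixed_of_improver (d : Fin K → ℕ) (v ε : Fin m → Fin m → Fin K → ℤ) (θ : ℤ)
    (Φ : Equiv.Perm (Fin m) × (Fin m → Fin K) → Equiv.Perm (Fin m) × (Fin m → Fin K))
    (q : Equiv.Perm (Fin m) × (Fin m → Fin K)) (hq : IsDominant d v ε θ q)
    (hpres : termSign ε (Φ q) ≠ 0) (hw : tropWeight d v θ q ≤ tropWeight d v θ (Φ q)) : Φ q = q :=
  eq_of_isDominant d v ε θ hq hpres hw

/-- **Column-diagonally-dominant designs: dominant permutations are the identity.** [folklore] -/
theorem perm_eq_one_of_dominant_diagDominant (d : Fin K → ℕ) (v ε : Fin m → Fin m → Fin K → ℤ)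
    (hεdiag : ∀ a b l, ε a b l ≠ 0 → ε b b l ≠ 0) (hvdiag : ∀ a b l, a ≠ b → v b b l < v a b l)
    (θ : ℤ) (σ : Equiv.Perm (Fin m)) (μ : Fin m → Fin K) (hp : IsDominant d v ε θ (σ, μ)) : σ = 1 := by
  by_contra hσ
  -- the identity term with the same classes is present
  have hpres : ∀ i, ε (σ i) i (μ i) ≠ 0 := present_of_termSign_ne_zero ε (σ, μ) hp.1
  have hid : termSign ε ((1 : Equiv.Perm (Fin m)), μ) ≠ 0 := by
    unfold termSign
    refine mul_ne_zero (by simp) (prod_ne_zero_iff.mpr fun i _ => ?_)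
    simpa using hεdiag _ _ _ (hpres i)
  have hne : ((1 : Equiv.Perm (Fin m)), μ) ≠ (σ, μ) := fun h => hσ (congrArg Prod.fst h).symm
  have hlt := hp.2 _ hne hid
  -- but its weight is at least that of `(σ, μ)`, strictly unless `σ = 1`
  obtain ⟨i₀, hi₀⟩ : ∃ i, σ i ≠ i := by
    by_contra hall
    push Not at hall
    exact hσ (Equiv.ext fun i => by simpa using hall i)
  have hle : ∀ i, v i i (μ i) ≤ v (σ i) i (μ i) := by
    intro i
    rcases eq_or_ne (σ i) i with h | h
    · rw [h]
    · exact (hvdiag _ _ _ h).le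
  have hsum : ∑ i, v i i (μ i) < ∑ i, v (σ i) i (μ i) :=
    sum_lt_sum (fun i _ => hle i) ⟨i₀, mem_univ _, hvdiag _ _ _ hi₀⟩
  unfold tropWeight at hlt
  simp only [Equiv.Perm.one_apply] at hlt
  linarith

/-- **Column-diagonally-dominant designs: `n ≤ m·(K−1)`** along every sign-alternating dominant chain (one permutation,
only class flips). [folklore] -/
theorem diagDominant_chain_le (d : Fin K → ℕ) (v ε : Fin m → Fin m → Fin K → ℤ)
    (hεdiag : ∀ a b l, ε a b l ≠ 0 → ε b b l ≠ 0) (hvdiag : ∀ a b l, a ≠ b → v b b l < v a b l)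
    {n : ℕ} (θ : Fin (n + 1) → ℤ) (p : Fin (n + 1) → Equiv.Perm (Fin m) × (Fin m → Fin K))
    (hθ : StrictMono θ) (hdom : ∀ k, IsDominant d v ε (θ k) (p k))
    (halt : ∀ k : Fin n, termSign ε (p k.castSucc) * termSign ε (p k.succ) < 0) : n ≤ m * (K - 1) := by
  classical
  have h := succ_le_card_perms_mul d v ε n θ p hθ hdom halt
  have himg : (univ.image fun k => (p k).1) = {1} := by
    ext σ
    simp only [mem_image, mem_univ, true_and, mem_singleton]
    constructor
    · rintro ⟨k, rfl⟩
      exact perm_eq_one_of_dominant_diagDominant d v ε hεdiag hvdiag (θ k) (p k).1 (p k).2 (hdom k)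
    · rintro rfl
      exact ⟨0, perm_eq_one_of_dominant_diagDominant d v ε hεdiag hvdiag (θ 0) (p 0).1 (p 0).2 (hdom 0)⟩
  rw [himg, card_singleton, one_mul] at h
  omega

/-- **Column-diagonally-dominant designs satisfy the crux's inequality with `C = 2`.**  HONEST RANGE: a degenerate class
(no permutation register). [folklore] -/
theorem diagDominant_kPlusLogSq (d : Fin K → ℕ) (v ε : Fin m → Fin m → Fin K → ℤ)
    (hεdiag : ∀ a b l, ε a b l ≠ 0 → ε b b l ≠ 0) (hvdiag : ∀ a b l, a ≠ b → v b b l < v a b l)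
    {n : ℕ} (θ : Fin (n + 1) → ℤ) (p : Fin (n + 1) → Equiv.Perm (Fin m) × (Fin m → Fin K))
    (hθ : StrictMono θ) (hdom : ∀ k, IsDominant d v ε (θ k) (p k))
    (halt : ∀ k : Fin n, termSign ε (p k.castSucc) * termSign ε (p k.succ) < 0) :
    n ≤ 2 ^ (2 * (K + Nat.log 2 m ^ 2)) := by
  have h := diagDominant_chain_le d v ε hεdiag hvdiag θ p hθ hdom halt
  rcases Nat.eq_zero_or_pos K with hK0 | hK0
  · subst hK0
    have : n ≤ 0 := by simpa using h
    exact this.trans (Nat.zero_le _)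
  set L := Nat.log 2 m with hL
  have hm : m < 2 ^ (L + 1) := hL ▸ Nat.lt_pow_succ_log_self (by norm_num) m
  have hK : K - 1 < 2 ^ K := lt_of_le_of_lt (Nat.sub_le K 1) Nat.lt_two_pow_self
  have h1 : m * (K - 1) ≤ 2 ^ (L + 1) * 2 ^ K := Nat.mul_le_mul hm.le hK.le
  have h2 : 2 ^ (L + 1) * 2 ^ K = 2 ^ (L + 1 + K) := (pow_add 2 _ _).symm
  have h3 : 2 ^ (L + 1 + K) ≤ 2 ^ (2 * (K + L ^ 2)) := Nat.pow_le_pow_right (by norm_num) (by nlinarith)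
  omega

end DiagDominant

end Summit.ValiantsHypothesis.ValiantsHypothesis.Theorems.KPlusLogSqLaw
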